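import Summits.Ventures.PercRepro.Night2NearFatPlanar

/-!
# night-2: THE SHAPE LEMMA OF THE NON-THREE-PLANAR CASE (gen 40)

Unless `V` is three-planar every load is a distance-1 load `Q_b ∪ {x}` (Night2NearFatPlanar), so its rank-2 set `R ⊆ T′`
has `|T′| = |R| + 4` (`exists_rank_two_card_of_dload_ne_zero_of_not_threePlanar`).  For a target `Q ∪ Y` of a basis pair
this reads `|R| = |Y| + 1` with `|R ∩ Q′| ≤ 2`: the line of `R` is a basis line carrying `≥ |Y| − 1` points of `Y`, or a
line through one basis point containing ALL of `Y` (no basis point is impossible).  **`dload_eq_zero_of_not_threePlanar_of_shape`**: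
a target whose `Y` has `≤ |Y| − 2` points on every basis line and is inside no line through a basis point is unloaded —
the load lemma for the middle levels that gen 39's paper §8.5 asked for, in the non-three-planar case.
Paper: proofs/NIGHT-2-g40.md §1.
-/

namespace PercRepro.Shadow

open PercRepro.ThmH PercRepro.PerFlat

variable {α : Type*} [DecidableEq α] {M : Matroid α} [M.Finite] {G : Finset α}

/-- **The rank-2 set of a load in the non-three-planar case has `|T ∖ K| = |R| + 4`.** -/
theorem exists_rank_two_card_of_dload_ne_zero_of_not_threePlanar (hG : G ∈ flatsQ M (5 + 1))
    (hd : (gr M \ G).card = 2) (hk : kColoops M G = 1) (hs : ∀ e ∈ gr M, ∀ f ∈ gr M, e ≠ f → rkN M {e, f} = 2)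
    (hl : ∀ e ∈ gr M, M.Indep {e}) (hfat : (fatClosures M 5 G 2).card ≤ 1)
    (hntp : ¬ (∃ R ⊆ G \ coloops M G, rkN M R = 2 ∧ ∃ c ∈ G \ coloops M G, ∃ d ∈ G \ coloops M G,
      ∃ e ∈ G \ coloops M G, G \ coloops M G ⊆ clF M (insert c R) ∪ clF M (insert d R) ∪ clF M (insert e R)))
    {T : Finset α} (hne : dload M 5 G (bigP M G) (dshGT2 M 5 G) T ≠ 0) :
    ∃ R ⊆ T \ coloops M G, rkN M R = 2 ∧ (T \ coloops M G).card = R.card + 4 := by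
  obtain ⟨B, hB, hbig, z, hz, hloss, x, hx, rfl⟩ :=
    exists_good_of_dload_ne_zero_of_not_threePlanar hG hd hk hs hl hfat hntp hne
  obtain ⟨R, hRQ, hR2, hRcard⟩ := exists_rank_two_of_loss_ne_zero hG hd hk hs hl hB hbig hz hloss
  have hxQ : x ∈ G \ insert z B := (mem_goodPts.1 hx).1
  have hKB : coloops M G ⊆ B := coloops_subset_of_mem_thinMembers hG (by omega) hB
  have hxK : x ∉ coloops M G := fun h => (Finset.mem_sdiff.1 hxQ).2 (Finset.mem_insert_of_mem (hKB h))
  have heq : insert x (insert z B) \ coloops M G = insert x (insert z B \ coloops M G) := insert_sdiff_coloops_eq hxK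
  refine ⟨R, hRQ.trans (by rw [heq]; exact Finset.subset_insert _ _), hR2, ?_⟩
  rw [heq, Finset.card_insert_of_notMem (fun h => (Finset.mem_sdiff.1 hxQ).2 (Finset.mem_sdiff.1 h).1)]
  omega

/-- **THE SHAPE LEMMA OF THE NON-THREE-PLANAR CASE**: a target `Q ∪ Y` of a basis pair whose `Y` has at most `|Y| − 2`
points on every basis line and lies inside no line through a basis point is unloaded. -/
theorem dload_eq_zero_of_not_threePlanar_of_shape (hG : G ∈ flatsQ M (5 + 1)) (hd : (gr M \ G).card = 2)
    (hk : kColoops M G = 1) (hs : ∀ e ∈ gr M, ∀ f ∈ gr M, e ≠ f → rkN M {e, f} = 2)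
    (hl : ∀ e ∈ gr M, M.Indep {e}) (hfat : (fatClosures M 5 G 2).card ≤ 1)
    (hntp : ¬ (∃ R ⊆ G \ coloops M G, rkN M R = 2 ∧ ∃ c ∈ G \ coloops M G, ∃ d ∈ G \ coloops M G,
      ∃ e ∈ G \ coloops M G, G \ coloops M G ⊆ clF M (insert c R) ∪ clF M (insert d R) ∪ clF M (insert e R)))
    {B : Finset α} (hB : B ∈ thinMembers M 5 G) (hnP : ¬ bigP M G B) {z : α} (hz : z ∈ G \ clF M B)
    {Y : Finset α} (hY : Y ⊆ G \ insert z B)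
    (h2 : ∀ a ∈ insert z B \ coloops M G, ∀ b ∈ insert z B \ coloops M G, a ≠ b →
      (Y ∩ clF M {a, b}).card + 2 ≤ Y.card)
    (h1 : ∀ a ∈ insert z B \ coloops M G, ∀ y ∈ Y, ¬ Y ⊆ clF M {a, y}) :
    dload M 5 G (bigP M G) (dshGT2 M 5 G) (insert z B ∪ Y) = 0 := by
  by_contra hne
  obtain ⟨R, hRT, hR2, hcard⟩ :=
    exists_rank_two_card_of_dload_ne_zero_of_not_threePlanar hG hd hk hs hl hfat hntp hne
  have hGg : G ⊆ gr M := (mem_flatsQ.1 hG).1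
  have hBG : B ⊆ G := subset_G_of_mem_thinMembers hB
  have hQG : insert z B ⊆ G := Finset.insert_subset (Finset.mem_sdiff.1 hz).1 hBG
  have hT'K := union_sdiff_coloops_eq_of_subset hG hd hB (z := z) hY
  have hcardT := card_union_sdiff_coloops_eq hG hd hk hB hnP hz hY
  have hind : M.Indep ((insert z B \ coloops M G : Finset α) : Set α) :=
    (indep_insert_of_basis_pair hG hd hk hB hnP hz).subset (by exact_mod_cast (Finset.sdiff_subset))
  have hRQ' : (R ∩ (insert z B \ coloops M G)).card ≤ 2 := by
    rw [Finset.inter_comm]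
    exact card_inter_le_two_of_indep_of_rkN_le_two hind hR2.le
  have hRg : R ⊆ gr M :=
    hRT.trans (Finset.sdiff_subset.trans ((Finset.union_subset hQG (hY.trans Finset.sdiff_subset)).trans hGg))
  have hRsub : R ⊆ (R ∩ (insert z B \ coloops M G)) ∪ (R ∩ Y) := by
    intro r hr
    have hrT := hRT hr
    rw [hT'K, Finset.mem_union] at hrT
    rcases hrT with h | h
    · exact Finset.mem_union_left _ (Finset.mem_inter.2 ⟨hr, h⟩)
    · exact Finset.mem_union_right _ (Finset.mem_inter.2 ⟨hr, h⟩)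
  have hRY : R.card ≤ (R ∩ (insert z B \ coloops M G)).card + (R ∩ Y).card := by
    have h1' := Finset.card_le_card hRsub
    have h2' := Finset.card_union_le (R ∩ (insert z B \ coloops M G)) (R ∩ Y)
    omega
  have hRcard : R.card = Y.card + 1 := by omega
  have hpairg : ∀ u v : α, u ∈ G → v ∈ G → ({u, v} : Finset α) ⊆ gr M := by
    intro u v hu hv e he
    rw [Finset.mem_insert, Finset.mem_singleton] at he
    rcases he with rfl | rfl
    · exact hGg hu
    · exact hGg hv
  have hline : ∀ u v : α, u ∈ G → v ∈ G → u ≠ v → u ∈ R → v ∈ R → R ⊆ clF M {u, v} := by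
    intro u v hu hv huv huR hvR
    exact subset_clF_of_rkN_le_two_of_two_mem hs hRg hR2.le huR hvR huv
      (subset_clF_of_subset_gr (hpairg u v hu hv) (Finset.mem_insert_self _ _))
      (subset_clF_of_subset_gr (hpairg u v hu hv) (Finset.mem_insert_of_mem (Finset.mem_singleton_self _)))
  have hWmem : ∀ y ∈ Y, y ∈ G := fun y hy => (Finset.mem_sdiff.1 (hY hy)).1
  have hQmem : ∀ a ∈ insert z B \ coloops M G, a ∈ G := fun a ha => hQG (Finset.mem_sdiff.1 ha).1
  rcases Nat.lt_or_ge (R ∩ (insert z B \ coloops M G)).card 1 with hr0 | hr1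
  · -- no basis point: `|R ∩ Y| ≥ |Y| + 1`, impossible
    have := Finset.card_le_card (Finset.inter_subset_right (s₁ := R) (s₂ := Y))
    omega
  · rcases Nat.lt_or_ge (R ∩ (insert z B \ coloops M G)).card 2 with hr1' | hr2
    · -- one basis point `a`: `Y ⊆ R ⊆ cl {a, y}`
      obtain ⟨a, ha⟩ := Finset.card_pos.1 (show 0 < (R ∩ (insert z B \ coloops M G)).card by omega)
      have hRY' : Y.card ≤ (R ∩ Y).card := by omega
      have hYR : Y ⊆ R := by
        have hsub : R ∩ Y ⊆ Y := Finset.inter_subset_right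
        have heq : R ∩ Y = Y := Finset.eq_of_subset_of_card_le hsub hRY'
        intro y hy
        rw [← heq] at hy
        exact (Finset.mem_inter.1 hy).1
      have hYne : Y.Nonempty := by
        rw [← Finset.card_pos]
        have := rkN_le_card (M := M) R
        omega
      obtain ⟨y, hy⟩ := hYne
      have hay : a ≠ y := by
        intro h
        subst h
        exact (Finset.mem_sdiff.1 (hY hy)).2 (Finset.mem_sdiff.1 (Finset.mem_inter.1 ha).2).1
      have hsub := hline a y (hQmem a (Finset.mem_inter.1 ha).2) (hWmem y hy) hay
        (Finset.mem_inter.1 ha).1 (hYR hy)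
      exact h1 a (Finset.mem_inter.1 ha).2 y hy (hYR.trans hsub)
    · -- two basis points `a ≠ b`: `|Y ∩ cl {a, b}| ≥ |Y| − 1`
      obtain ⟨a, ha, b, hb, hab⟩ := Finset.one_lt_card.1 (show 1 < (R ∩ (insert z B \ coloops M G)).card by omega)
      have hsub := hline a b (hQmem a (Finset.mem_inter.1 ha).2) (hQmem b (Finset.mem_inter.1 hb).2) hab
        (Finset.mem_inter.1 ha).1 (Finset.mem_inter.1 hb).1
      have hc : R ∩ Y ⊆ Y ∩ clF M {a, b} := fun r hr =>
        Finset.mem_inter.2 ⟨(Finset.mem_inter.1 hr).2, hsub (Finset.mem_inter.1 hr).1⟩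
      have hc' := Finset.card_le_card hc
      have hb' := h2 a (Finset.mem_inter.1 ha).2 b (Finset.mem_inter.1 hb).2 hab
      omega

end PercRepro.Shadow
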